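import Literature.NumberTheory.Transcendental.KZCalculusOver
import Summits.KontsevichZagierPeriods.KontsevichZagierPeriods.Theorems.SoloInformedTameEquidecompFamilies
import HarnessLib

/-!
# The bounded sub-calculus of `KZ_k`

The four moves of the Kontsevich–Zagier calculus with coefficients in `k`
(`KZOver.domainAddRel`, `integrandAddRel`, `changeOfVariablesRel`, `newtonLeibnizRel`, file
`Literature.NumberTheory.Transcendental.KZCalculusOver`) restricted to BOUNDED integral
representations (bounded domain, integrand bounded on the domain: `SoloInformedBddRep`), and the
subgroup `soloInformedRelationsBdd k ≤ KZOver.relations k` they generate ("bounded chains").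
For bounded data absolute integrability is automatic, which is what makes the side conditions of a
fixed-shape chain first-order in its real parameters (THEOREM R / THEOREM T of the residency paper,
`real-parameters.md`; kernel programme (ζ″), files `SoloInformedBdd*`, `SoloInformedParam*`).

Also: the rectangle `[0,1] × [0,ℓ]` with integrand `1` over `ℝ` (`soloInformedRealRect ℓ`, value `ℓ`),
the right-hand endpoint of THEOREM R, and base change of bounded relations along `k → k'`.

References: [cite: KontsevichZagier2001, §1.2]; [cite: BochnakCosteRoy1998, §2.2].
-/

noncomputable section

open Set MeasureTheory MvPolynomial Literature.ModelTheory.ExponentialFields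
  Literature.NumberTheory.Transcendental

namespace Summit.KontsevichZagierPeriods.KontsevichZagierPeriods.Theorems

variable {k : Type*} [CommRing k] [Algebra k ℝ] {n m : ℕ}

/-! ### Bounded representations and the bounded moves -/

/-- A representation is *bounded* if its domain lies in a coordinate box `[-M, M]ⁿ` and its
integrand is bounded by `M` on the domain. [cite: KontsevichZagier2001, §1.1] -/
def SoloInformedBddRep (r : KZOver.IntegralRep k n) : Prop :=
  ∃ M : ℝ, (∀ x ∈ r.domain, ∀ i, |x i| ≤ M) ∧ ∀ x ∈ r.domain, |r.integrand x| ≤ M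

variable (k) in
/-- Move (1a), additivity in the domain, between bounded representations.
[cite: KontsevichZagier2001, §1.2 rule (1)] -/
def soloInformedBddDomainAddRel : Set (KZOver.FormalRep k) :=
  {c | ∃ (n : ℕ) (r r₁ r₂ : KZOver.IntegralRep k n),
    SoloInformedBddRep r ∧ SoloInformedBddRep r₁ ∧ SoloInformedBddRep r₂ ∧
    r.domain = r₁.domain ∪ r₂.domain ∧ volume (r₁.domain ∩ r₂.domain) = 0 ∧
    EqOn r.integrand r₁.integrand r₁.domain ∧ EqOn r.integrand r₂.integrand r₂.domain ∧
    c = KZOver.of r - KZOver.of r₁ - KZOver.of r₂}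

variable (k) in
/-- Move (1b), additivity in the integrand, between bounded representations.
[cite: KontsevichZagier2001, §1.2 rule (1)] -/
def soloInformedBddIntegrandAddRel : Set (KZOver.FormalRep k) :=
  {c | ∃ (n : ℕ) (r r₁ r₂ : KZOver.IntegralRep k n),
    SoloInformedBddRep r ∧ SoloInformedBddRep r₁ ∧ SoloInformedBddRep r₂ ∧
    r₁.domain = r.domain ∧ r₂.domain = r.domain ∧
    EqOn r.integrand (r₁.integrand + r₂.integrand) r.domain ∧
    c = KZOver.of r - KZOver.of r₁ - KZOver.of r₂}

variable (k) in
/-- Move (2), change of variables, between bounded representations (data exactly as in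
`KZOver.changeOfVariablesRel`). [cite: KontsevichZagier2001, §1.2 rule (2)] -/
def soloInformedBddChangeOfVariablesRel : Set (KZOver.FormalRep k) :=
  {c | ∃ (n : ℕ) (r r' : KZOver.IntegralRep k n) (Φ : (Fin n → ℝ) → (Fin n → ℝ))
      (Φ' : (Fin n → ℝ) → (Fin n → ℝ) →L[ℝ] (Fin n → ℝ)),
    SoloInformedBddRep r ∧ SoloInformedBddRep r' ∧
    IsSemialgebraicMapOn k r.domain Φ ∧ (∀ x ∈ r.domain, HasFDerivWithinAt Φ (Φ' x) r.domain x) ∧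
    InjOn Φ r.domain ∧ r'.domain = Φ '' r.domain ∧
    (∀ x ∈ r.domain, r.integrand x = r'.integrand (Φ x) * |(Φ' x).det|) ∧
    c = KZOver.of r - KZOver.of r'}

variable (k) in
/-- Move (3), Newton–Leibniz along the last coordinate, between bounded representations (data
exactly as in `KZOver.newtonLeibnizRel`). [cite: KontsevichZagier2001, §1.2 rule (3)] -/
def soloInformedBddNewtonLeibnizRel : Set (KZOver.FormalRep k) :=
  {c | ∃ (n : ℕ) (r : KZOver.IntegralRep k (n + 1)) (r' : KZOver.IntegralRep k n)
      (a b : (Fin n → ℝ) → ℝ) (F : (Fin (n + 1) → ℝ) → ℝ),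
    SoloInformedBddRep r ∧ SoloInformedBddRep r' ∧
    IsSemialgebraicFunOn k r.domain F ∧
    IsSemialgebraicFunOn k r'.domain a ∧ IsSemialgebraicFunOn k r'.domain b ∧
    (∀ x ∈ r'.domain, a x ≤ b x) ∧
    r.domain = {z | (Fin.init z : Fin n → ℝ) ∈ r'.domain ∧ a (Fin.init z) ≤ z (Fin.last n) ∧
      z (Fin.last n) ≤ b (Fin.init z)} ∧
    (∀ x ∈ r'.domain, ContinuousOn (fun t : ℝ => F (Fin.snoc x t)) (Icc (a x) (b x))) ∧
    (∀ x ∈ r'.domain, ∀ t ∈ Ioo (a x) (b x),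
      HasDerivAt (fun s : ℝ => F (Fin.snoc x s)) (r.integrand (Fin.snoc x t)) t) ∧
    (∀ x ∈ r'.domain, r'.integrand x = F (Fin.snoc x (b x)) - F (Fin.snoc x (a x))) ∧
    c = KZOver.of r - KZOver.of r'}

variable (k) in
/-- The union of the four bounded move sets (the generators of bounded chains).
[cite: KontsevichZagier2001, §1.2] -/
def soloInformedBddGenerators : Set (KZOver.FormalRep k) :=
  soloInformedBddDomainAddRel k ∪ soloInformedBddIntegrandAddRel k ∪
    soloInformedBddChangeOfVariablesRel k ∪ soloInformedBddNewtonLeibnizRel k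

variable (k) in
/-- **Bounded relations**: the subgroup of `KZOver.FormalRep k` generated by the four moves
between bounded representations ("differences of the ends of bounded chains").
[cite: KontsevichZagier2001, §1.2] -/
def soloInformedRelationsBdd : AddSubgroup (KZOver.FormalRep k) :=
  AddSubgroup.closure (soloInformedBddGenerators k)

/-- The bounded domain-additivity move is a domain-additivity move.
[cite: KontsevichZagier2001, §1.2] -/
theorem soloInformedBddDomainAddRel_subset :
    soloInformedBddDomainAddRel k ⊆ KZOver.domainAddRel k := by
  rintro c ⟨n, r, r₁, r₂, -, -, -, hdom, hnull, h₁, h₂, rfl⟩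
  exact ⟨n, r, r₁, r₂, hdom, hnull, h₁, h₂, rfl⟩

/-- The bounded integrand-additivity move is an integrand-additivity move.
[cite: KontsevichZagier2001, §1.2] -/
theorem soloInformedBddIntegrandAddRel_subset :
    soloInformedBddIntegrandAddRel k ⊆ KZOver.integrandAddRel k := by
  rintro c ⟨n, r, r₁, r₂, -, -, -, h₁, h₂, hadd, rfl⟩
  exact ⟨n, r, r₁, r₂, h₁, h₂, hadd, rfl⟩

/-- The bounded change-of-variables move is a change-of-variables move.
[cite: KontsevichZagier2001, §1.2] -/
theorem soloInformedBddChangeOfVariablesRel_subset :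
    soloInformedBddChangeOfVariablesRel k ⊆ KZOver.changeOfVariablesRel k := by
  rintro c ⟨n, r, r', Φ, Φ', -, -, hΦ, hΦ', hinj, hdom, hf, rfl⟩
  exact ⟨n, r, r', Φ, Φ', hΦ, hΦ', hinj, hdom, hf, rfl⟩

/-- The bounded Newton–Leibniz move is a Newton–Leibniz move. [cite: KontsevichZagier2001, §1.2] -/
theorem soloInformedBddNewtonLeibnizRel_subset :
    soloInformedBddNewtonLeibnizRel k ⊆ KZOver.newtonLeibnizRel k := by
  rintro c ⟨n, r, r', a, b, F, -, -, hF, ha, hb, hab, hdom, hcont, hderiv, hr', rfl⟩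
  exact ⟨n, r, r', a, b, F, hF, ha, hb, hab, hdom, hcont, hderiv, hr', rfl⟩

/-- The bounded generators are generators of `KZOver.relations k`.
[cite: KontsevichZagier2001, §1.2] -/
theorem soloInformedBddGenerators_subset_relations :
    soloInformedBddGenerators k ⊆ (KZOver.relations k : Set (KZOver.FormalRep k)) := by
  rintro c (((hc | hc) | hc) | hc)
  · exact KZOver.domainAddRel_subset_relations (soloInformedBddDomainAddRel_subset hc)
  · exact KZOver.integrandAddRel_subset_relations (soloInformedBddIntegrandAddRel_subset hc)
  · exact KZOver.changeOfVariablesRel_subset_relations (soloInformedBddChangeOfVariablesRel_subset hc)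
  · exact KZOver.newtonLeibnizRel_subset_relations (soloInformedBddNewtonLeibnizRel_subset hc)

variable (k) in
/-- **Bounded relations are relations.** [cite: KontsevichZagier2001, §1.2] -/
theorem soloInformedRelationsBdd_le_relations : soloInformedRelationsBdd k ≤ KZOver.relations k :=
  (AddSubgroup.closure_le _).2 soloInformedBddGenerators_subset_relations

/-- Generators are bounded relations. [cite: KontsevichZagier2001, §1.2] -/
theorem soloInformed_mem_relationsBdd_of_mem_generators {c : KZOver.FormalRep k}
    (hc : c ∈ soloInformedBddGenerators k) : c ∈ soloInformedRelationsBdd k :=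
  AddSubgroup.subset_closure hc

/-- **Soundness of bounded chains**: evaluation vanishes on bounded relations.
[cite: KontsevichZagier2001, §1.2] -/
theorem soloInformed_eval_eq_zero_of_mem_relationsBdd {c : KZOver.FormalRep k}
    (hc : c ∈ soloInformedRelationsBdd k) : KZOver.eval k c = 0 :=
  KZOver.eval_eq_zero_of_mem_relations (soloInformedRelationsBdd_le_relations k hc)

/-- Two representations are *boundedly equivalent over `k`* if `[r] − [r']` is a bounded
relation, i.e. they are the ends of a bounded `KZ_k` chain. [cite: KontsevichZagier2001, §1.2] -/
def SoloInformedBddEquivalent (r : KZOver.IntegralRep k n) (r' : KZOver.IntegralRep k m) : Prop :=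
  KZOver.of r - KZOver.of r' ∈ soloInformedRelationsBdd k

/-- Boundedly equivalent representations are equivalent. [cite: KontsevichZagier2001, §1.2] -/
theorem SoloInformedBddEquivalent.equivalent {r : KZOver.IntegralRep k n}
    {r' : KZOver.IntegralRep k m} (h : SoloInformedBddEquivalent r r') : KZOver.Equivalent r r' :=
  soloInformedRelationsBdd_le_relations k h

/-- Boundedly equivalent representations represent the same number.
[cite: KontsevichZagier2001, §1.2] -/
theorem SoloInformedBddEquivalent.value_eq {r : KZOver.IntegralRep k n}
    {r' : KZOver.IntegralRep k m} (h : SoloInformedBddEquivalent r r') : r.value = r'.value :=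
  h.equivalent.value_eq

/-! ### Base change of bounded relations along `k → k'` -/

section BaseChange

variable (k' : Type*) [CommRing k'] [Algebra k' ℝ] [Algebra k k'] [IsScalarTower k k' ℝ]

/-- Boundedness is unchanged by base change (same domain and integrand).
[cite: KontsevichZagier2001, §1.1] -/
theorem soloInformedBddRep_baseChange_iff (r : KZOver.IntegralRep k n) :
    SoloInformedBddRep (r.baseChange k') ↔ SoloInformedBddRep r := Iff.rfl

/-- Base change maps bounded generators over `k` to bounded generators over `k'`.
[cite: KontsevichZagier2001, §1.2] -/
theorem soloInformed_baseChange_mem_bddGenerators {c : KZOver.FormalRep k}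
    (hc : c ∈ soloInformedBddGenerators k) :
    KZOver.baseChange k k' c ∈ soloInformedBddGenerators k' := by
  rcases hc with (((hc | hc) | hc) | hc)
  · obtain ⟨n, r, r₁, r₂, hr, hr₁, hr₂, hdom, hnull, h₁, h₂, rfl⟩ := hc
    exact Or.inl (Or.inl (Or.inl ⟨n, r.baseChange k', r₁.baseChange k', r₂.baseChange k',
      hr, hr₁, hr₂, hdom, hnull, h₁, h₂, by simp only [map_sub, KZOver.baseChange_of]⟩))
  · obtain ⟨n, r, r₁, r₂, hr, hr₁, hr₂, h₁, h₂, hadd, rfl⟩ := hc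
    exact Or.inl (Or.inl (Or.inr ⟨n, r.baseChange k', r₁.baseChange k', r₂.baseChange k',
      hr, hr₁, hr₂, h₁, h₂, hadd, by simp only [map_sub, KZOver.baseChange_of]⟩))
  · obtain ⟨n, r, r', Φ, Φ', hr, hr', hΦ, hΦ', hinj, hdom, hf, rfl⟩ := hc
    exact Or.inl (Or.inr ⟨n, r.baseChange k', r'.baseChange k', Φ, Φ', hr, hr',
      hΦ.baseChange k', hΦ', hinj, hdom, hf, by simp only [map_sub, KZOver.baseChange_of]⟩)
  · obtain ⟨n, r, r', a, b, F, hr, hr', hF, ha, hb, hab, hdom, hcont, hderiv, hr'F, rfl⟩ := hc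
    exact Or.inr ⟨n, r.baseChange k', r'.baseChange k', a, b, F, hr, hr', hF.baseChange k',
      ha.baseChange k', hb.baseChange k', hab, hdom, hcont, hderiv, hr'F,
      by simp only [map_sub, KZOver.baseChange_of]⟩

variable (k) in
/-- **Base change maps bounded relations over `k` into bounded relations over `k'`**: a bounded
`KZ_k` chain is a bounded `KZ_{k'}` chain. [cite: KontsevichZagier2001, §1.2] -/
theorem soloInformed_map_baseChange_relationsBdd_le :
    (soloInformedRelationsBdd k).map (KZOver.baseChange k k') ≤ soloInformedRelationsBdd k' := by
  rw [soloInformedRelationsBdd, AddMonoidHom.map_closure]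
  refine (AddSubgroup.closure_le _).2 ?_
  rintro _ ⟨c, hc, rfl⟩
  exact AddSubgroup.subset_closure (soloInformed_baseChange_mem_bddGenerators k' hc)

/-- Elementwise form of `soloInformed_map_baseChange_relationsBdd_le`.
[cite: KontsevichZagier2001, §1.2] -/
theorem soloInformed_baseChange_mem_relationsBdd {c : KZOver.FormalRep k}
    (hc : c ∈ soloInformedRelationsBdd k) :
    KZOver.baseChange k k' c ∈ soloInformedRelationsBdd k' :=
  soloInformed_map_baseChange_relationsBdd_le k k' (AddSubgroup.mem_map_of_mem _ hc)

end BaseChange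

/-! ### The rectangle `[0,1] × [0,ℓ]` with integrand `1` -/

/-- The side vector `(1, ℓ)` of the rectangle `[0,1] × [0,ℓ]`. [cite: KontsevichZagier2001, §1.1] -/
def soloInformedRealRectSide (ℓ : ℝ) : Fin 2 → ℝ := ![1, ℓ]

/-- The rectangle `[0,1] × [0,ℓ] ⊆ ℝ²` is `ℝ`-semialgebraic. [cite: BochnakCosteRoy1998, §2.1] -/
theorem soloInformed_isSemialgebraic_rectBox (ℓ : ℝ) :
    IsSemialgebraic ℝ (soloInformedTameBox (soloInformedRealRectSide ℓ)) := by
  have hset : soloInformedTameBox (soloInformedRealRectSide ℓ) =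
      ⋂ j ∈ (Finset.univ : Finset (Fin 2)),
        ({x : Fin 2 → ℝ | aeval x (0 : MvPolynomial (Fin 2) ℝ) ≤
          aeval x (X j : MvPolynomial (Fin 2) ℝ)} ∩
        {x | aeval x (X j : MvPolynomial (Fin 2) ℝ) ≤
          aeval x (C (soloInformedRealRectSide ℓ j) : MvPolynomial (Fin 2) ℝ)}) := by
    ext x
    simp only [soloInformedTameBox, mem_univ_pi, mem_Icc, Finset.mem_univ, iInter_true, mem_iInter,
      mem_inter_iff, mem_setOf_eq, map_zero, aeval_X, aeval_C, Algebra.algebraMap_self,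
      RingHom.id_apply]
  rw [hset]
  exact IsSemialgebraic.biInter _ _ fun j _ =>
    (isSemialgebraic_setOf_eval_le _ _).inter (isSemialgebraic_setOf_eval_le _ _)

/-- The rectangle `[0,1] × [0,ℓ]` has finite volume `ℓ` (for `0 ≤ ℓ`).
[cite: EvansGariepy1992, §1.1] -/
theorem soloInformed_volume_rectBox (ℓ : ℝ) :
    volume (soloInformedTameBox (soloInformedRealRectSide ℓ)) = ENNReal.ofReal ℓ := by
  rw [soloInformedTameBox, volume_pi_pi]
  simp only [Real.volume_Icc, sub_zero, Fin.prod_univ_two, soloInformedRealRectSide,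
    Matrix.cons_val_zero, Matrix.cons_val_one, ENNReal.ofReal_one, one_mul]

/-- The rectangle has finite volume. [cite: EvansGariepy1992, §1.1] -/
theorem soloInformed_volume_rectBox_lt_top (ℓ : ℝ) :
    volume (soloInformedTameBox (soloInformedRealRectSide ℓ)) < ⊤ := by
  rw [soloInformedTameBox, volume_pi_pi]
  exact ENNReal.prod_lt_top fun j _ => by simp [Real.volume_Icc]

/-- **The representation `[[0,1] × [0,ℓ], 1]` of `KZ_ℝ`** (a real-semialgebraic datum when `ℓ` is
transcendental). [cite: KontsevichZagier2001, §1.1] -/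
def soloInformedRealRect (ℓ : ℝ) : KZOver.IntegralRep ℝ 2 where
  domain := soloInformedTameBox (soloInformedRealRectSide ℓ)
  integrand _ := 1
  isSemialgebraic_domain := soloInformed_isSemialgebraic_rectBox ℓ
  isSemialgebraicFunOn_integrand :=
    (isSemialgebraicFunOn_aeval (soloInformed_isSemialgebraic_rectBox ℓ)
      (1 : MvPolynomial (Fin 2) ℝ)).congr fun x _ => by simp
  integrableOn := (integrableOn_const_iff).2 (Or.inr (soloInformed_volume_rectBox_lt_top ℓ))

/-- The domain of the rectangle representation. [cite: KontsevichZagier2001, §1.1] -/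
@[simp] theorem soloInformedRealRect_domain (ℓ : ℝ) :
    (soloInformedRealRect ℓ).domain = soloInformedTameBox (soloInformedRealRectSide ℓ) := rfl

/-- The integrand of the rectangle representation is `1`. [cite: KontsevichZagier2001, §1.1] -/
@[simp] theorem soloInformedRealRect_integrand (ℓ : ℝ) (x : Fin 2 → ℝ) :
    (soloInformedRealRect ℓ).integrand x = 1 := rfl

/-- Membership in the rectangle, coordinatewise. [cite: KontsevichZagier2001, §1.1] -/
theorem soloInformed_mem_rect_domain_iff (ℓ : ℝ) (x : Fin 2 → ℝ) :
    x ∈ (soloInformedRealRect ℓ).domain ↔ (0 ≤ x 0 ∧ x 0 ≤ 1) ∧ (0 ≤ x 1 ∧ x 1 ≤ ℓ) := by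
  simp only [soloInformedRealRect_domain, soloInformedTameBox, mem_univ_pi, mem_Icc, Fin.forall_fin_two,
    soloInformedRealRectSide, Matrix.cons_val_zero, Matrix.cons_val_one]

/-- **`value [[0,1] × [0,ℓ], 1] = ℓ`** for `0 ≤ ℓ`. [cite: KontsevichZagier2001, §1.1] -/
theorem soloInformedRealRect_value {ℓ : ℝ} (hℓ : 0 ≤ ℓ) : (soloInformedRealRect ℓ).value = ℓ := by
  rw [KZOver.IntegralRep.value]
  simp only [soloInformedRealRect_integrand, soloInformedRealRect_domain]
  rw [setIntegral_const, smul_eq_mul, mul_one, Measure.real, soloInformed_volume_rectBox ℓ,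
    ENNReal.toReal_ofReal hℓ]

/-- The rectangle representation is bounded. [cite: KontsevichZagier2001, §1.1] -/
theorem soloInformedBddRep_rect (ℓ : ℝ) : SoloInformedBddRep (soloInformedRealRect ℓ) := by
  refine ⟨max 1 |ℓ|, fun x hx i => ?_, fun x _ => by simp⟩
  rw [soloInformed_mem_rect_domain_iff] at hx
  fin_cases i
  · simpa [abs_of_nonneg hx.1.1] using Or.inl hx.1.2
  · have h1 : |x 1| ≤ |ℓ| := by rw [abs_of_nonneg hx.2.1]; exact hx.2.2.trans (le_abs_self ℓ)
    simpa using Or.inr h1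

/-- A representation with compact domain and integrand `1` on it is bounded (e.g. the sub-graph
solids `[E_q, 1]`). [cite: KontsevichZagier2001, §1.1] -/
theorem soloInformedBddRep_of_isCompact_of_integrand_one {r : KZOver.IntegralRep k n}
    (hc : IsCompact r.domain) (h1 : ∀ x ∈ r.domain, r.integrand x = 1) : SoloInformedBddRep r := by
  obtain ⟨R, hR⟩ := hc.isBounded.subset_closedBall 0
  refine ⟨max 1 R, fun x hx i => ?_, fun x hx => by simp [h1 x hx]⟩
  have h := (norm_le_pi_norm x i).trans (mem_closedBall_zero_iff.1 (hR hx))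
  rw [Real.norm_eq_abs] at h
  exact le_max_of_le_right h

end Summit.KontsevichZagierPeriods.KontsevichZagierPeriods.Theorems
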